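import Mathlib
import Summits.NavierStokesRegularity.NavierStokesRegularity.Theorems.HeteroclinicTriggerChainTriggerChainFrontStepNormalForm
import HarnessLib

/-!
# `HeteroclinicTriggerChain` — crux `TriggerChainFrontStep` (item stmt-NavierStokesRegularity-22785):
  the TRIGGER ROW of the cascade nonlinearity for ARBITRARY families

Companion to `…TriggerChainFrontStepCarrierRow` (carrier rows = signed squares) and to the normal form
(`stub_normal_form`). Under the (parity) clause of the crux — every structure constant with an odd
number of trigger slots `i₁` vanishes — the row of the trigger mode `i₁` is LINEAR in the trigger
amplitudes: for every family `X` (all modes, all shells) and every shell `n`,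

  `quadTerm 1 α X i₁ n = 2^{5n/2} · ( 2u_n · ∑_b α i₁ b i₁ (0,0,0) X_{b,n}`
  `                        + 2u_{n+1} · ∑_b α i₁ b i₁ (1,0,0) X_{b,n} + 2u_n · ∑_b α b i₁ i₁ (1,0,0) X_{b,n+1} )`
  `                     + 2^{5(n−1)/2} · 2u_{n−1} · ∑_b α i₁ b i₁ (0,0,1) X_{b,n−1}`,   `u_m := X_{i₁,m}`

(`htcTR_quadTerm_trigger`; symmetry (4.2) merges the mirror blocks). In the normal form the carrier
entries of these four coefficient rows are `α i₁ i₀ i₁ (0,0,0) = d i₁ 0/2 = e/2`, `α i₁ i₀ i₁ (1,0,0) = 0`,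
`α i₀ i₁ i₁ (1,0,0) = −g/2` (`g = α i₁ i₁ i₀ (0,0,1)`), `α i₁ i₀ i₁ (0,0,1) = 0`
(`htcTR_trigger_carrier_coefficients`), so the row reads `e·x·u − g·y·u` plus terms each carrying a
junk-mode amplitude (modes `∉ {i₀, i₁}`) — the lattice `u′` with its exact remainder (`f₂` of the forced
arc / the rate perturbation of the delay-phase windows).

HONEST FRAMING: finite algebra of structure constants of Tao-type MODEL lattices (Tao 2016 §4); helper for
the crux (no stub credit); nothing here is a statement about the Navier–Stokes equations; no summit,
rung or crux is proved by this file.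
-/

noncomputable section

set_option linter.dupNamespace false

namespace Summit.NavierStokesRegularity.NavierStokesRegularity.Theorems

open Literature.Analysis.FluidPDE Literature.Analysis.FluidPDE.TaoCascade

/-- A double sum over `Fin 4 × Fin 4` of a summand vanishing unless EXACTLY ONE index is `i₁` splits
into the row `a = i₁` and the column `b = i₁`. [folklore] -/
theorem htcTR_sum_parity_split (f : Fin 4 → Fin 4 → ℝ) (i₁ : Fin 4)
    (hf : ∀ a b, (a = i₁ ↔ b = i₁) → f a b = 0) :
    ∑ a, ∑ b, f a b = ∑ b, f i₁ b + ∑ a, f a i₁ := by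
  have hpt : ∀ a b, f a b = (if a = i₁ then f a b else 0) + (if b = i₁ then f a b else 0) := by
    intro a b
    by_cases ha : a = i₁
    · by_cases hb : b = i₁
      · rw [if_pos ha, if_pos hb, hf a b (iff_of_true ha hb)]; ring
      · rw [if_pos ha, if_neg hb]; ring
    · by_cases hb : b = i₁
      · rw [if_neg ha, if_pos hb]; ring
      · rw [if_neg ha, if_neg hb, hf a b (iff_of_false ha hb)]; ring
  rw [Finset.sum_congr rfl fun a _ => Finset.sum_congr rfl fun b _ => hpt a b]
  simp only [Finset.sum_add_distrib]
  congr 1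
  · rw [Finset.sum_congr rfl fun a _ => show (∑ b : Fin 4, if a = i₁ then f a b else 0) =
        if a = i₁ then ∑ b : Fin 4, f a b else 0 by
      by_cases ha : a = i₁ <;> simp [ha]]
    simp only [Finset.sum_ite_eq', Finset.mem_univ, if_true]
  · exact Finset.sum_congr rfl fun a _ => by
      simp only [Finset.sum_ite_eq', Finset.mem_univ, if_true]

/-- **TRIGGER ROW FOR ARBITRARY FAMILIES.** For a symmetric table with the (parity) clause for the
trigger mode `i₁` (every entry with an odd number of `i₁`-slots vanishes), for EVERY family `X` and
shell `n`: `quadTerm 1 α X i₁ n t = 2^{5n/2}·(2u_n·∑_b α i₁ b i₁(000)X_{b,n} + 2u_{n+1}·∑_b α i₁ b i₁(100)X_{b,n}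
+ 2u_n·∑_b α b i₁ i₁(100)X_{b,n+1}) + 2^{5(n−1)/2}·2u_{n−1}·∑_b α i₁ b i₁(001)X_{b,n−1}` with
`u_m = X i₁ m t` — linear in the trigger amplitudes of shells `n−1, n, n+1`. [this file] -/
theorem htcTR_quadTerm_trigger (α : Fin 4 → Fin 4 → Fin 4 → ℤ × ℤ × ℤ → ℝ) (i₁ : Fin 4)
    (hsym : IsSymmetricCoeff α)
    (hpar : ∀ (j₁ j₂ j₃ : Fin 4) (μ : ℤ × ℤ × ℤ),
      Xor (Xor (j₁ = i₁) (j₂ = i₁)) (j₃ = i₁) → α j₁ j₂ j₃ μ = 0)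
    (X : Fin 4 → ℤ → ℝ → ℝ) (n : ℤ) (t : ℝ) :
    quadTerm 1 α X i₁ n t =
      (1 + 1 : ℝ) ^ ((5 : ℝ) * n / 2) *
          (2 * X i₁ n t * ∑ b, α i₁ b i₁ (0, 0, 0) * X b n t +
            2 * X i₁ (n + 1) t * ∑ b, α i₁ b i₁ (1, 0, 0) * X b n t +
            2 * X i₁ n t * ∑ b, α b i₁ i₁ (1, 0, 0) * X b (n + 1) t) +
        (1 + 1 : ℝ) ^ ((5 : ℝ) * ((n : ℝ) - 1) / 2) *
          (2 * X i₁ (n - 1) t * ∑ b, α i₁ b i₁ (0, 0, 1) * X b (n - 1) t) := by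
  -- parity on the row i₁: the entry vanishes unless exactly one input slot is i₁
  have hz : ∀ (a b : Fin 4) (μ : ℤ × ℤ × ℤ), (a = i₁ ↔ b = i₁) → α a b i₁ μ = 0 := by
    intro a b μ hab
    refine hpar a b i₁ μ ?_
    by_cases ha : a = i₁
    · have hb : b = i₁ := hab.1 ha
      simp [Xor, ha, hb]
    · have hb : ¬ b = i₁ := fun hb => ha (hab.2 hb)
      simp [Xor, ha, hb]
  have m000 : ((0 : ℤ), (0 : ℤ), (0 : ℤ)) ∈ shiftSet := by decide
  have m001 : ((0 : ℤ), (0 : ℤ), (1 : ℤ)) ∈ shiftSet := by decide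
  have m010 : ((0 : ℤ), (1 : ℤ), (0 : ℤ)) ∈ shiftSet := by decide
  have sym000 : ∀ a b c : Fin 4, α a b c (0, 0, 0) = α b a c (0, 0, 0) :=
    fun a b c => hsym a b c 0 0 0 m000
  have sym001 : ∀ a b c : Fin 4, α a b c (0, 0, 1) = α b a c (0, 0, 1) :=
    fun a b c => hsym a b c 0 0 1 m001
  have sym010 : ∀ a b c : Fin 4, α a b c (0, 1, 0) = α b a c (1, 0, 0) :=
    fun a b c => hsym a b c 0 1 0 m010
  rw [htcNF_quadTerm_expand]
  -- split the same-shell/back-reaction block into its three parts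
  have hsplit3 : ∑ a : Fin 4, ∑ b : Fin 4,
      (α a b i₁ (0, 0, 0) * (X a n t * X b n t) + α a b i₁ (1, 0, 0) * (X a (n + 1) t * X b n t) +
        α a b i₁ (0, 1, 0) * (X a n t * X b (n + 1) t)) =
      ∑ a : Fin 4, ∑ b : Fin 4, α a b i₁ (0, 0, 0) * (X a n t * X b n t) +
        ∑ a : Fin 4, ∑ b : Fin 4, α a b i₁ (1, 0, 0) * (X a (n + 1) t * X b n t) +
        ∑ a : Fin 4, ∑ b : Fin 4, α a b i₁ (0, 1, 0) * (X a n t * X b (n + 1) t) := by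
    simp only [Finset.sum_add_distrib]
  rw [hsplit3]
  -- each block by the parity split
  have h000 := htcTR_sum_parity_split (fun a b => α a b i₁ (0, 0, 0) * (X a n t * X b n t)) i₁
    (fun a b hab => show α a b i₁ (0, 0, 0) * (X a n t * X b n t) = 0 by
      rw [hz a b _ hab, zero_mul])
  have h100 := htcTR_sum_parity_split (fun a b => α a b i₁ (1, 0, 0) * (X a (n + 1) t * X b n t)) i₁
    (fun a b hab => show α a b i₁ (1, 0, 0) * (X a (n + 1) t * X b n t) = 0 by
      rw [hz a b _ hab, zero_mul])
  have h010 := htcTR_sum_parity_split (fun a b => α a b i₁ (0, 1, 0) * (X a n t * X b (n + 1) t)) i₁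
    (fun a b hab => show α a b i₁ (0, 1, 0) * (X a n t * X b (n + 1) t) = 0 by
      rw [hz a b _ hab, zero_mul])
  have h001 := htcTR_sum_parity_split
    (fun a b => α a b i₁ (0, 0, 1) * (X a (n - 1) t * X b (n - 1) t)) i₁
    (fun a b hab => show α a b i₁ (0, 0, 1) * (X a (n - 1) t * X b (n - 1) t) = 0 by
      rw [hz a b _ hab, zero_mul])
  rw [h000, h100, h010, h001]
  -- symmetrise the column sums
  have c000 : ∑ a : Fin 4, α a i₁ i₁ (0, 0, 0) * (X a n t * X i₁ n t) =
      ∑ b : Fin 4, α i₁ b i₁ (0, 0, 0) * (X i₁ n t * X b n t) :=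
    Finset.sum_congr rfl fun a _ => by rw [sym000 a i₁ i₁]; ring
  have c010a : ∑ b : Fin 4, α i₁ b i₁ (0, 1, 0) * (X i₁ n t * X b (n + 1) t) =
      ∑ b : Fin 4, α b i₁ i₁ (1, 0, 0) * (X i₁ n t * X b (n + 1) t) :=
    Finset.sum_congr rfl fun b _ => by rw [sym010 i₁ b i₁]
  have c010b : ∑ a : Fin 4, α a i₁ i₁ (0, 1, 0) * (X a n t * X i₁ (n + 1) t) =
      ∑ b : Fin 4, α i₁ b i₁ (1, 0, 0) * (X i₁ (n + 1) t * X b n t) :=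
    Finset.sum_congr rfl fun a _ => by rw [sym010 a i₁ i₁]; ring
  have c001 : ∑ a : Fin 4, α a i₁ i₁ (0, 0, 1) * (X a (n - 1) t * X i₁ (n - 1) t) =
      ∑ b : Fin 4, α i₁ b i₁ (0, 0, 1) * (X i₁ (n - 1) t * X b (n - 1) t) :=
    Finset.sum_congr rfl fun a _ => by rw [sym001 a i₁ i₁]; ring
  rw [c000, c010a, c010b, c001]
  simp only [Finset.mul_sum]
  have e1 : ∀ b : Fin 4, α i₁ b i₁ (0, 0, 0) * (X i₁ n t * X b n t) =
      X i₁ n t * (α i₁ b i₁ (0, 0, 0) * X b n t) := fun b => by ring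
  have e2 : ∀ b : Fin 4, α i₁ b i₁ (1, 0, 0) * (X i₁ (n + 1) t * X b n t) =
      X i₁ (n + 1) t * (α i₁ b i₁ (1, 0, 0) * X b n t) := fun b => by ring
  have e3 : ∀ a : Fin 4, α a i₁ i₁ (1, 0, 0) * (X a (n + 1) t * X i₁ n t) =
      X i₁ n t * (α a i₁ i₁ (1, 0, 0) * X a (n + 1) t) := fun a => by ring
  have e4 : ∀ b : Fin 4, α b i₁ i₁ (1, 0, 0) * (X i₁ n t * X b (n + 1) t) =
      X i₁ n t * (α b i₁ i₁ (1, 0, 0) * X b (n + 1) t) := fun b => by ring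
  have e5 : ∀ b : Fin 4, α i₁ b i₁ (0, 0, 1) * (X i₁ (n - 1) t * X b (n - 1) t) =
      X i₁ (n - 1) t * (α i₁ b i₁ (0, 0, 1) * X b (n - 1) t) := fun b => by ring
  simp only [e1, e2, e3, e4, e5, ← Finset.mul_sum]
  ring

/-- **The carrier entries of the trigger row in normal form.** With `d i₁ 0 = e` and
`g := α i₁ i₁ i₀ (0,0,1)`: `α i₁ i₀ i₁ (0,0,0) = d i₁ 0 / 2`, `α i₁ i₀ i₁ (1,0,0) = 0`,
`α i₀ i₁ i₁ (1,0,0) = −g/2`, `α i₁ i₀ i₁ (0,0,1) = 0` — so the carrier contributions to the four sums of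
`htcTR_quadTerm_trigger` are `e·x_n·u_n` (same shell), `0` (upper trigger × carrier),
`−g·y_n·u_n` (receiver quench) and `0` (wake trigger × wake carrier). [this file] -/
theorem htcTR_trigger_carrier_coefficients (α : Fin 4 → Fin 4 → Fin 4 → ℤ × ℤ × ℤ → ℝ)
    (i₀ i₁ : Fin 4) (d : Fin 4 → ℤ → ℝ)
    (hsym : IsSymmetricCoeff α) (hcanc : IsCancellingCoeff α)
    (hpure : ∀ X : Fin 4 → ℤ → ℝ → ℝ, (∀ i n t, i ≠ i₀ → X i n t = 0) →
      ∀ i n t, quadTerm 1 α X i n t = 0)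
    (hsad : ∀ (Y : Fin 4 → ℤ → ℝ → ℝ) (i : Fin 4) (n : ℤ) (t : ℝ),
      quadTerm 1 α (fun j m s => (fun j m (_ : ℝ) => if j = i₀ ∧ m = 0 then (1 : ℝ) else 0) j m s +
          Y j m s) i n t -
        quadTerm 1 α (fun j m (_ : ℝ) => if j = i₀ ∧ m = 0 then (1 : ℝ) else 0) i n t -
        quadTerm 1 α Y i n t = d i n * Y i n t) :
    α i₁ i₀ i₁ (0, 0, 0) = d i₁ 0 / 2 ∧ α i₁ i₀ i₁ (1, 0, 0) = 0 ∧
      α i₀ i₁ i₁ (1, 0, 0) = -(α i₁ i₁ i₀ (0, 0, 1)) / 2 ∧ α i₁ i₀ i₁ (0, 0, 1) = 0 := by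
  obtain ⟨-, nf2, -, nf4, -, -, -, -, nf9⟩ :=
    HeteroclinicTriggerChain.stub_normal_form α i₀ d hsym hcanc hpure hsad
  have m000 : ((0 : ℤ), (0 : ℤ), (0 : ℤ)) ∈ shiftSet := by decide
  refine ⟨?_, (nf2 i₁ i₁).2.2.1, (nf9 i₁).2.1, (nf2 i₁ i₁).2.1⟩
  rw [hsym i₁ i₀ i₁ 0 0 0 m000, nf4 i₁]
  ring

end Summit.NavierStokesRegularity.NavierStokesRegularity.Theorems

end
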